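import Summits.KontsevichZagierPeriods.KontsevichZagierPeriods.Theorems.TerasomaMultiplicationBetaCancellationOfPiCancellation
import Summits.KontsevichZagierPeriods.KontsevichZagierPeriods.Theorems.CompiledSubstitutionsPiNormalisation
import Summits.KontsevichZagierPeriods.KontsevichZagierPeriods.Theorems.TerasomaMultiplicationBetaCancellationStubFmcDescent
import Summits.KontsevichZagierPeriods.KontsevichZagierPeriods.Theorems.TerasomaMultiplicationBetaCancellationStubPencilSheets
import Summits.KontsevichZagierPeriods.KontsevichZagierPeriods.Theorems.TerasomaMultiplicationBetaCancellationStubTameForm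
import Literature.NumberTheory.Transcendental.KZProductIdeal
import Literature.NumberTheory.Transcendental.KZCalculusProofs

/-!
# Crux `BetaCancellation` (stmt-KontsevichZagierPeriods-13633) — line `divisor-slicing-transshipment`, skeleton v5 (lead a1)

Skeleton of the line (planner skeleton v1 registered 2026-08-17T04:57Z, sha c918e428…; rebuilt by the
lead seat a1 from the registered stub signatures, which are reproduced VERBATIM below).

The line works entirely on the `KZ.PiCancellation` (item 0540) side of the proved bridge
`BetaCancellationLine.betaCancellation_of_piCancellation`, with the catalyst `[π]` presented as the
Cauchy line `K = [ℝ, 1/(1+x²)]` (`∼ [disc]` by `piNormalisation_proof`):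

* `stub_tameForm` — one-bijection normal form with a CATALYTIC spectator: a certificate
  `[K × r] − [K × r'] ∈ relations` yields positive representations `A`, `B` with
  `[r] − [r'] ≡ [A] − [B]` and a finite piecewise `ℚ`-semialgebraic measure isomorphism
  `Ψ : K × A → K × B` (c6 F13 + absorption of the spectator into `K × M'` through the disc chart
  `K × [0,1) ≅ D`, after double stabilisation).
* `stub_pencilSheets` — structure of the pencil slices `{arctan Ψ₀ ≡ N·arctan t + arctan τ}` of a
  semialgebraic map: for every slope `N` and all but finitely many rational `τ`, finitely many
  semialgebraic sheets `t = θ_i(a)` over semialgebraic pieces cover the slice a.e. (cylindrical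
  decomposition, `IsSemialgebraic.exists_cylindricalDecomposition_holds`).
* `stub_pencilTransshipment` — THE CRUX⁺ (feasibility): some finite family of pencil sheets of `Ψ`
  carries `ℚ`-semialgebraic weights with both marginals exact.
* `stub_fmcDescent` — finite measured correspondence descent: exact weighted sheets between pieces
  of `A` and `B` give `A ∼ B` (rules (1a), (1b), (2) only).

Composition: `cauchyCancellation` (the four stubs) → `piCancellation` (`exists_integralRep_sub_holds`,
`Equivalent.prod`, `piNormalisation_proof`, two-sided ideal) → `BetaCancellation_of`
(`betaCancellation_of_piCancellation`). Sorries: `stub_pencilTransshipment` ONLY (v3: `stub_fmcDescent` p143926; v4: `stub_pencilSheets` p145476; v5: `stub_tameForm` p152715).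
-/

noncomputable section

set_option linter.dupNamespace false

open MeasureTheory Set
open Literature.NumberTheory.Transcendental
open Literature.NumberTheory.Transcendental.KZ
open Literature.ModelTheory.ExponentialFields (IsSemialgebraic isSemialgebraic_univ)

namespace Summit.KontsevichZagierPeriods.KontsevichZagierPeriods.BetaCancellationDivisorSlicing

/-! ## The four registered stubs (signatures verbatim from the registry, skeleton c918e428) -/

-- stub_fmcDescent: PROVED — `Theorems/TerasomaMultiplicationBetaCancellationStubFmcDescent.lean` (p143926, worker of lead a1),
-- same namespace, imported above; signature as registered (Lines file v2 L53).

-- stub_pencilSheets: PROVED — `Theorems/TerasomaMultiplicationBetaCancellationStubPencilSheets.lean` (p145476, worker of lead a1;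
-- aux p144496 …StubPencilSheetsAux.lean: CAD sheets of a thin semialgebraic set, finiteness of fat pencil levels), imported above.

-- stub_tameForm: PROVED — `Theorems/TerasomaMultiplicationBetaCancellationStubTameForm.lean` (p152715, worker of lead a1; 26 files:
-- …DivisorSlicingDefs (MIso/Shadow), …StubTameFormAux1,3–27: K₀-shadow of the four rules incl. rule (3) via CAD, extraction, catalytic
-- absorption through the Cauchy–disc chart, realisation), imported above.

/-- STUB (the crux⁺ — pencil transshipment feasibility). Given the one-bijection form
`Ψ : K × A → K × B` and the pencil supply, some finite family of pencil sheets of `Ψ` carries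
`ℚ`-semialgebraic weights with exact source marginal `A.integrand` and exact target marginal
`B.integrand`. [folklore] -/
theorem stub_pencilTransshipment : ∀ (d : ℕ) (A B : IntegralRep d), (∀ a ∈ A.domain, 0 < A.integrand a) → (∀ b ∈ B.domain, 0 < B.integrand b) → ∀ (J : ℕ) (S : Fin J → Set (Fin (1 + d) → ℝ)) (Ψ : Fin J → (Fin (1 + d) → ℝ) → (Fin (1 + d) → ℝ)) (Ψ' : Fin J → (Fin (1 + d) → ℝ) → ((Fin (1 + d) → ℝ) →L[ℝ] (Fin (1 + d) → ℝ))), ((∀ j, IsSemialgebraic ℚ (S j) ∧ S j ⊆ {z | (fun i => z (Fin.natAdd 1 i)) ∈ A.domain} ∧ IsSemialgebraicMapOn ℚ (S j) (Ψ j) ∧ Set.InjOn (Ψ j) (S j) ∧ (∀ z ∈ S j, HasFDerivWithinAt (Ψ j) (Ψ' j z) (S j) z) ∧ Ψ j '' S j ⊆ {z | (fun i => z (Fin.natAdd 1 i)) ∈ B.domain} ∧ ∀ z ∈ S j, 1 / (1 + z (Fin.castAdd d 0) ^ 2) * A.integrand (fun i => z (Fin.natAdd 1 i)) = 1 / (1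 + (Ψ j z) (Fin.castAdd d 0) ^ 2) * B.integrand (fun i => (Ψ j z) (Fin.natAdd 1 i)) * |(Ψ' j z).det|) ∧ (∀ j j', j ≠ j' → volume (S j ∩ S j') = 0 ∧ volume (Ψ j '' S j ∩ Ψ j' '' S j') = 0) ∧ volume ({z : Fin (1 + d) → ℝ | (fun i => z (Fin.natAdd 1 i)) ∈ A.domain} \ ⋃ j, S j) = 0 ∧ volume ({z : Fin (1 + d) → ℝ | (fun i => z (Fin.natAdd 1 i)) ∈ B.domain} \ ⋃ j, Ψ j '' S j) = 0) → -- the pencil supply: for every piece and slope, all but finitely many rational `τ` give a sliced sheet system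
    (∀ (j : Fin J) (N : ℕ), ∃ E : Finset ℚ, ∀ τ : ℚ, τ ∉ E → ∃ (m : ℕ) (U : Fin m → Set (Fin d → ℝ)) (θ : Fin m → (Fin d → ℝ) → ℝ), (∀ i, IsSemialgebraic ℚ (U i) ∧ IsSemialgebraicFunOn ℚ (U i) (θ i)) ∧ (∀ i, ∀ a ∈ U i, Fin.append (fun _ : Fin 1 => θ i a) a ∈ S j ∧ Real.cos ((N : ℝ) * Real.arctan (θ i a) + Real.arctan (τ : ℝ)) ≠ 0 ∧ Ψ j (Fin.append (fun _ : Fin 1 => θ i a) a) (Fin.castAdd d 0) = Real.tan ((N : ℝ) * Real.arctan (θ i a) + Real.arctan (τ : ℝ))) ∧ (∀ i i', i ≠ i' → ∀ a ∈ U i ∩ U i', θ i a ≠ θ i' a) ∧ volume {a : Fin d → ℝ | ∃ t : ℝ, Fin.append (fun _ : Fin 1 => t) a ∈ S j ∧ Real.cos ((N : ℝ) * Real.arctan t + Real.arctan (τ : ℝ)) ≠ 0 ∧ Ψ j (Fin.append (fun _ : Fin 1 => t) a) (Fin.castAdd d 0) = Real.tan ((N : ℝ) * Real.arctan t + Real.arctan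 (τ : ℝ)) ∧ ∀ i, ¬ (a ∈ U i ∧ θ i a = t)} = 0) → ∃ (m : ℕ) (U : Fin m → Set (Fin d → ℝ)) (s : Fin m → (Fin d → ℝ) → (Fin d → ℝ)) (s' : Fin m → (Fin d → ℝ) → ((Fin d → ℝ) →L[ℝ] (Fin d → ℝ))) (w g : Fin m → (Fin d → ℝ) → ℝ), -- provenance: every sheet is a pencil sheet of some piece
    (∀ i, ∃ (j : Fin J) (N : ℕ) (τ : ℚ) (θ : (Fin d → ℝ) → ℝ), IsSemialgebraicFunOn ℚ (U i) θ ∧ ∀ a ∈ U i, Fin.append (fun _ : Fin 1 => θ a) a ∈ S j ∧ Real.cos ((N : ℝ) * Real.arctan (θ a) + Real.arctan (τ : ℝ)) ≠ 0 ∧ Ψ j (Fin.append (fun _ : Fin 1 => θ a) a) (Fin.castAdd d 0) = Real.tan ((N : ℝ) * Real.arctan (θ a) + Real.arctan (τ : ℝ)) ∧ s i a = fun k => Ψ j (Fin.append (fun _ : Fin 1 => θ a) a) (Fin.natAdd 1 k)) ∧ -- the finite measured correspondence (exactly the hypotheses of `stub_fmcDescent`)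
    (∀ i, IsSemialgebraic ℚ (U i) ∧ U i ⊆ A.domain) ∧ (∀ i, IsSemialgebraicMapOn ℚ (U i) (s i) ∧ Set.InjOn (s i) (U i) ∧ (∀ a ∈ U i, HasFDerivWithinAt (s i) (s' i a) (U i) a) ∧ s i '' U i ⊆ B.domain) ∧ (∀ i, IsSemialgebraicFunOn ℚ (U i) (w i) ∧ IntegrableOn (w i) (U i) ∧ IsSemialgebraicFunOn ℚ (s i '' U i) (g i) ∧ IntegrableOn (g i) (s i '' U i) ∧ ∀ a ∈ U i, w i a = g i (s i a) * |(s' i a).det|) ∧ (fun a => ∑ i, (U i).indicator (w i) a) =ᵐ[volume.restrict A.domain] A.integrand ∧ (fun b => ∑ i, (s i '' U i).indicator (g i) b) =ᵐ[volume.restrict B.domain] B.integrand := by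
  sorry

/-! ## Composition -/

/-- **Cauchy-line cancellation** from the four stubs: for the Cauchy representation
`K = [ℝ, 1/(1+x²)]` and any `r`, `r'`, a certificate `[K × r] − [K × r'] ∈ relations` yields
`r ∼ r'` — tame form, pencil sheets, transshipment, finite-measured-correspondence descent.
[folklore] -/
theorem cauchyCancellation ⦃n m : ℕ⦄ (r : IntegralRep n) (r' : IntegralRep m) (K : IntegralRep 1)
    (hKd : K.domain = Set.univ) (hKi : Set.EqOn K.integrand (fun x => 1 / (1 + x 0 ^ 2)) K.domain)
    (h : of (K.prod r) - of (K.prod r') ∈ relations) : Equivalent r r' := by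
  obtain ⟨d, A, B, hA, hB, hrel, J, S, Ψ, Ψ', hΨ, hdisj, hcovA, hcovB⟩ :=
    stub_tameForm r r' K hKd hKi h
  have hsupply := fun (j : Fin J) (N : ℕ) =>
    stub_pencilSheets d (S j) (Ψ j) (hΨ j).1 (hΨ j).2.2.1 N
  obtain ⟨m', U, s, s', w, g, -, hU, hs, hw, hmA, hmB⟩ :=
    stub_pencilTransshipment d A B hA hB J S Ψ Ψ' ⟨hΨ, hdisj, hcovA, hcovB⟩ hsupply
  have hAB : Equivalent A B := stub_fmcDescent d A B m' U s s' w g hU hs hw hmA hmB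
  have hsum := relations.add_mem hrel hAB
  have : of r - of r' = of r - of r' - (of A - of B) + (of A - of B) := by abel
  rw [Equivalent, this]
  exact hsum

/-- A Cauchy-line representation `[ℝ, 1/(1+x²)]` of `π` exists (rational integrand, integrable by
`integrable_inv_one_add_sq`). [Kontsevich–Zagier 2001, §1.1] [cite: KontsevichZagier2001, §1.1] -/
theorem exists_cauchyRep : ∃ K : IntegralRep 1, K.domain = Set.univ ∧
    K.integrand = fun x => 1 / (1 + x 0 ^ 2) := by
  have hu : IsSemialgebraic ℚ (Set.univ : Set (Fin 1 → ℝ)) := isSemialgebraic_univ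
  have hf : IsSemialgebraicFunOn ℚ (Set.univ : Set (Fin 1 → ℝ)) (fun x => 1 / (1 + x 0 ^ 2)) := by
    have h := isSemialgebraicFunOn_aeval_div_aeval hu
      (1 : MvPolynomial (Fin 1) ℚ) (1 + MvPolynomial.X 0 ^ 2) (fun x _ => by
        simp only [map_add, map_one, map_pow, MvPolynomial.aeval_X]
        positivity)
    exact h.congr fun x _ => by
      simp only [map_add, map_one, map_pow, MvPolynomial.aeval_X]
  have hi : IntegrableOn (fun x : Fin 1 → ℝ => 1 / (1 + x 0 ^ 2)) Set.univ := by
    rw [integrableOn_univ]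
    have hg : Integrable (fun t : ℝ => 1 / (1 + t ^ 2)) := by
      refine integrable_inv_one_add_sq.congr (Filter.Eventually.of_forall fun t => ?_)
      simp only [one_div]
    exact ((volume_preserving_funUnique (Fin 1) ℝ).integrable_comp_emb
      (MeasurableEquiv.measurableEmbedding _)).mpr hg
  exact ⟨⟨Set.univ, fun x => 1 / (1 + x 0 ^ 2), hu, hf, hi⟩, rfl, rfl⟩

/-- **`KZ.PiCancellation` from Cauchy-line cancellation** (item 0540 for this line): reduce a
formal combination `c` to a difference `[r] − [r']` (`exists_integralRep_sub_holds`), trade the disc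
for the Cauchy line (`piNormalisation_proof`, `Equivalent.prod`), cancel. [folklore] -/
theorem piCancellation : KZ.PiCancellation := by
  intro c hc
  obtain ⟨n, m, r, r', hcr⟩ := exists_integralRep_sub_holds c
  obtain ⟨K, hKd, hKi⟩ := exists_cauchyRep
  have hKi' : Set.EqOn K.integrand (fun x => 1 / (1 + x 0 ^ 2)) K.domain := by
    rw [hKi]; exact fun _ _ => rfl
  -- `K ∼ [disc]`
  have hKπ : Equivalent K piRep :=
    (Summit.KontsevichZagierPeriods.CompiledSubstitutions.PiNormalisation.piNormalisation_proof
      piRep rfl (fun _ _ => rfl)).1 K hKd hKi'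
  -- `[π] · ([r] − [r']) ∈ relations`
  have h1 : of piRep * (of r - of r') ∈ relations := by
    have h' : of piRep * (c - (of r - of r')) ∈ relations := piRep_mul_mem_relations hcr
    have h'' : of piRep * c - of piRep * (c - (of r - of r')) ∈ relations := relations.sub_mem hc h'
    have : of piRep * (of r - of r') = of piRep * c - of piRep * (c - (of r - of r')) := by
      simp only [mul_sub]; abel
    rw [this]; exact h''
  -- trade the disc for the Cauchy line on both products
  have h2 : of (K.prod r) - of (K.prod r') ∈ relations := by
    have hr : Equivalent (K.prod r) (piRep.prod r) := hKπ.prod (Equivalent.refl r)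
    have hr' : Equivalent (K.prod r') (piRep.prod r') := hKπ.prod (Equivalent.refl r')
    have hπ : of (piRep.prod r) - of (piRep.prod r') ∈ relations := by
      rwa [mul_sub, of_mul_of, of_mul_of] at h1
    have hsum := relations.add_mem (relations.add_mem hr hπ) (relations.neg_mem hr')
    have : of (K.prod r) - of (K.prod r') =
        of (K.prod r) - of (piRep.prod r) + (of (piRep.prod r) - of (piRep.prod r')) +
          -(of (K.prod r') - of (piRep.prod r')) := by abel
    rw [this]; exact hsum
  have h3 : Equivalent r r' := cauchyCancellation r r' K hKd hKi' h2
  have : c = c - (of r - of r') + (of r - of r') := by abel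
  rw [this]
  exact relations.add_mem hcr h3

/-- **The crux from the line**: `BetaCancellation` follows from the four stubs through
`piCancellation` and the proved bridge `betaCancellation_of_piCancellation`. [folklore] -/
theorem BetaCancellation_of :
    Summit.KontsevichZagierPeriods.KontsevichZagierPeriods.Theses.TerasomaMultiplication.BetaCancellation :=
  Summit.KontsevichZagierPeriods.KontsevichZagierPeriods.BetaCancellationLine.betaCancellation_of_piCancellation
    piCancellation

end Summit.KontsevichZagierPeriods.KontsevichZagierPeriods.BetaCancellationDivisorSlicing

end
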